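import Summits.QuantumFields.BalabanUV.T4Continuum.Spine.NE3.FlatLandauRep
import Summits.QuantumFields.BalabanUV.T4Continuum.Spine.NE3.LandauCorrectionSupB8FlatUnit
import HarnessLib

/-!
# T⁴ programme, node NE3 — brick E at ONE BLOCK: THE PLAIN EXACT LATTICE LANDAU GAUGE `div log U^{u} ≡ 0` WITH SUP MEMBER, on any torus of side `T ≥ 2`
# (`FlatLandauPlain`) — the flat END `FlatLandauRep.exists_flatLandauRep_of_supFacts` read with ONE block = the whole torus (`L′ = T`, `N′ = 1`, `j′ = 0`)

Cell `pub-balaban`, rung (B)+1 sub-cell t4, row NE3 (OWNER lineage `b2b-balaban-t4-ne3-p1`, generation 27).  A one-screen corollary FOR THE CRUX PROVER NE7's REP♭⁻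
gradient member (road v2 §3; INBOX [NE3P1-G27-INBOX-2] (A)): (157) `NE7GradientCurrency.norm_fdiff_le_of_plaqDiv_periodic` needs the Landau reaction `P = sup‖∇ div A‖`;
the (1.38)-gauge relative to `N(Q′(1))` only makes `Δ_1 div A` block-constant, but the PLAIN exact gauge `div A ≡ 0` gives `P = 0`.  That gauge IS the flat END at one block:
with `(L′, N′, j′) := (T, 1, 0)` B8's test space `N(Q′(1))` is every skew periodic mean-zero site field, `IsLandauB8 T 1 1 flatCfg Z` forces `covDiv 1 Z ≡ 0`
(pub-balaban-gaps ne3's `SlicePoincareSlicB8Flat.covDiv_eq_zero_of_isLandauB8_flatCfg_unit`), and the letters are the tree's `supRegularity_flatCfg` (`c₀ = 16d³`, `c₁ = 16d²`,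
with `M′ = T`) and the unit-torus (HR) `LandauCorrectionSupB8FlatUnit.covLapSite_sup_le_two_mul_flatCfg_unit` (**`c_R = 2`**).

WHAT ([folklore]; 0 def, 0 sorry): **`exists_plainLandau_gauge`** — `d ≥ 1`, `T ≥ 2`; `U` unitary `T`-periodic with `‖U(b) − 1‖ ≤ r₀`, `‖div log U‖_∞ ≤ b₀` and the four
lines of the flat END at `(c₀, c₁, c_R, M) = (16d³, 16d², 2, T)` (all `O(1)` iff `T·r₀`, `T²·b₀` are small — at fixed torus; this is the place where the plain gauge is
NOT uniform in the number of blocks, cf. NE7's F1): ∃ `u` unitary `T`-periodic, `Z` skew `T`-periodic with `U^{u} = vary flatCfg Z 1`, **`covDiv flatCfg Z x = 0` for all `x`**,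
`‖U^{u}(b) − 1‖ ≤ r₀ + 160d²·T·b₀`, `‖Z(b)‖ ≤ 2(r₀ + 160d²·T·b₀)`, `‖u − 1‖ ≤ 128d³·T²·b₀`.

HONEST FRAMING (page 1): a corollary of our flat fixed-point theorem; nothing of Bałaban's asserted or discharged; REP♭ ∕ NE3 ∕ NE7 NOT proved; spine PROVED 0∕9;
finite T⁴ rung (B)+1 — NOT infinite volume, NOT mass gap, NOT `BetaPertH`, NOT Clay.  Continuum YM on T⁴ ⇐ BetaPertH ∧ nine spine estimates (0/9 proved); BetaPertH ⇐
(D1) ∧ (D4) ∧ CAP+tail; G-an2-4 gates asym, D1 and NE2/3/4.  PLACEMENT: our lemma, `Spine/NE3/`.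
-/

set_option autoImplicit false

open NormedSpace
open scoped BigOperators Matrix.Norms.L2Operator
open Finset

namespace Summit.QuantumFields.BalabanUV.T4Continuum.NE3.FlatLandauPlain

open Literature.MathematicalPhysics.QuantumFieldTheory.Balaban1983to89
open B7Prop1Explicit B7Prop2Explicit MatrixLog
open T4AveragingDeficitWall (IsUnitaryCfg IsSkewDir vary)
open T4AveragingDeficitWallBoundary (IsPeriodicCfg)
open AveragingDeficitPeriodicCounting (IsPeriodicDir)
open MinimalActionWitness (flatCfg)
open NE3EnergyShapes (IsUnitarySite IsPeriodicSite)
open NE3CovariantWeitzenbock (covDiv)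
open NE3.LandauCorrectionSupB8FlatH0 (supRegularity_flatCfg)
open NE3.LandauCorrectionSupB8FlatUnit (covLapSite_sup_le_two_mul_flatCfg_unit)
open NE3.SlicePoincareSlicB8Flat (covDiv_eq_zero_of_isLandauB8_flatCfg_unit)
open NE3.FlatLandauRep (exists_flatLandauRep_of_supFacts)

noncomputable section

variable {d : ℕ} {n : Type*} [Fintype n] [DecidableEq n]

/-- **THE PLAIN EXACT LATTICE LANDAU GAUGE WITH SUP MEMBER** (one block = the whole torus of side `T ≥ 2`; statement in the module docstring). [folklore] -/
theorem exists_plainLandau_gauge [Nonempty n] (hd : 1 ≤ d) {T : ℕ} (hT : 2 ≤ T)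
    {U : Site d → Fin d → (Matrix n n ℂ)ˣ} (hUu : IsUnitaryCfg U) (hUP : IsPeriodicCfg U (T : ℤ))
    {r₀ b₀ : ℝ} (hr₀ : ∀ (y : Site d) (μ : Fin d), ‖((U y μ : (Matrix n n ℂ)ˣ) : Matrix n n ℂ) - 1‖ ≤ r₀)
    (hb₀ : ∀ x : Site d, ‖covDiv (flatCfg (d := d) (n := n)) (fun y μ => mlog ((U y μ : (Matrix n n ℂ)ˣ) : Matrix n n ℂ)) x‖ ≤ b₀)
    (hreg₁ : 16 * (d : ℝ) ^ 3 * (T : ℝ) ^ 2 * (2 * b₀) ≤ 1 / 10) (hreg₂ : 16 * (d : ℝ) ^ 2 * (T : ℝ) * (2 * b₀) ≤ 1 / 25)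
    (hreg₃ : r₀ + 5 / 2 * (16 * (d : ℝ) ^ 2 * (T : ℝ) * (2 * b₀)) ≤ 1 / 20)
    (hline : 2 * (4 * (16 * (d : ℝ) ^ 3 * (T : ℝ) ^ 2) * (b₀ + 4 * (2 * b₀)) + 25 * d * (r₀ + 5 / 2 * (16 * (d : ℝ) ^ 2 * (T : ℝ) * (2 * b₀))) * (16 * (d : ℝ) ^ 2 * (T : ℝ))
        + 14 * d * (16 * (d : ℝ) ^ 2 * (T : ℝ)) ^ 2 * (2 * b₀)) ≤ 1 / 2) :
    ∃ (u : Site d → (Matrix n n ℂ)ˣ) (Z : Site d → Fin d → Matrix n n ℂ),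
      IsUnitarySite u ∧ IsPeriodicSite u (T : ℤ) ∧ IsSkewDir Z ∧ IsPeriodicDir Z (T : ℤ) ∧
      gaugeAct u U = vary (flatCfg (d := d) (n := n)) Z 1 ∧ (∀ x : Site d, covDiv (flatCfg (d := d) (n := n)) Z x = 0) ∧
      (∀ (y : Site d) (μ : Fin d), ‖((gaugeAct u U y μ : (Matrix n n ℂ)ˣ) : Matrix n n ℂ) - 1‖ ≤ r₀ + 5 / 2 * (16 * (d : ℝ) ^ 2 * (T : ℝ) * (2 * b₀))) ∧
      (∀ (y : Site d) (μ : Fin d), ‖Z y μ‖ ≤ 2 * (r₀ + 5 / 2 * (16 * (d : ℝ) ^ 2 * (T : ℝ) * (2 * b₀)))) ∧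
      (∀ y : Site d, ‖((u y : (Matrix n n ℂ)ˣ) : Matrix n n ℂ) - 1‖ ≤ 4 * (16 * (d : ℝ) ^ 3 * (T : ℝ) ^ 2 * (2 * b₀))) := by
  have hT1 : 1 ≤ T := by omega
  have hper : ((1 * T ^ (0 + 1) : ℕ) : ℤ) = (T : ℤ) := by push_cast; ring
  have hpow : ((T : ℝ) ^ (0 + 1)) = (T : ℝ) := by ring
  have hUP' : IsPeriodicCfg U ((1 * T ^ (0 + 1) : ℕ) : ℤ) := by rw [hper]; exact hUP
  obtain ⟨u, Z, huU, huP, hZs, hZP, hrep, hLan, hr, hZ, hu1, -⟩ :=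
    exists_flatLandauRep_of_supFacts hd hT (le_refl 1) 0 (c₀ := 16 * (d : ℝ) ^ 3) (c₁ := 16 * (d : ℝ) ^ 2) (cR := 2)
      (by positivity) (by positivity) (by norm_num)
      (fun mu hmu B hB => supRegularity_flatCfg hT1 (le_refl 1) 0 hmu hB)
      (fun F hFs hFP mu hmu horth B hFB y => covLapSite_sup_le_two_mul_flatCfg_unit hT 0 F hFs hFP hmu horth hFB y)
      hUu hUP' hr₀ hb₀ (by rw [hpow]; linarith [hreg₁]) (by rw [hpow]; linarith [hreg₂]) (by rw [hpow]; linarith [hreg₃])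
      (by rw [hpow]; linarith [hline])
  have hdiv := covDiv_eq_zero_of_isLandauB8_flatCfg_unit hT 0 hZs hZP hLan
  refine ⟨u, Z, huU, fun y i => ?_, hZs, fun y i μ => ?_, hrep, hdiv, fun y μ => ?_, fun y μ => ?_, fun y => ?_⟩
  · have h := huP y i; rwa [hper] at h
  · have h := hZP y i μ; rwa [hper] at h
  · have h := hr y μ; rwa [hpow] at h
  · have h := hZ y μ; rwa [hpow] at h
  · have h := hu1 y; rwa [hpow] at h

end

end Summit.QuantumFields.BalabanUV.T4Continuum.NE3.FlatLandauPlain
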